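import Summits.BirchSwinnertonDyer.BirchSwinnertonDyer.Theorems.ThetaPartnerAtTwoMazurTateCongruenceAtTwoRAssembly
import Summits.BirchSwinnertonDyer.BirchSwinnertonDyer.Theorems.ResidualThetaTransportAtTwoThetaLayerLambdaCongruenceAtTwoCruxOfCuspSpan
import Summits.BirchSwinnertonDyer.BirchSwinnertonDyer.Theorems.ByReductionTypeAtTwoSupersingularThetaHabitatPlusNegDisc
import Literature.NumberTheory.EllipticCurves.ModularJacobianTorsionHeckeSelfDualProofs
import HarnessLib

/-!
# Crux `MazurTateCongruenceAtTwoTop` (stmt-BirchSwinnertonDyer-25797 = `MazurTateCongruenceAtTwoR` 21416), line `symbol`: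
# the symbol-`μ` statement `Hμ` from the curve-free node `CuspSpanEvenAtTwo`, and THE CRUX BY NAME behind
# PUB⁶ + `realPeriodRat_eq_unit_mul_plusPeriod_two` + «`CuspSpanEvenAtTwo N` at every odd level»
# (width seat bsd-wall-tp2-p1-w2 g2; `--supports stmt-BirchSwinnertonDyer-25797`; closes nothing)

HONEST FRAMING. THEOREMS ONLY. Every Literature named fact (`eichlerShimura_depletedOptimalQuotient_periodLattice_of_dvd`,
`WeierstrassCurve.isIsogenous_iff_frobeniusTrace_eq`, `mazurKenku_exists_cyclic_isogeny`, `heckeSelfDual_torsionBy_J0` /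
`periodHomology_exists_heckeSelfAdjoint_perfectPairing`, `buzzard2000_multiplicityOne_gamma0`,
`serre1972_supersingular_decompositionSubgroup_image`, `realPeriodRat_eq_unit_mul_plusPeriod_two`) and the route
ResidualThetaTransportAtTwo's `@[conjecture]` predicate `SignedMuAtTwo.CuspSpanEvenAtTwo N` (`…ResidualThetaTransportAtTwoCuspSpanDefs`,
rtt-p4 g5, p595076) are explicit HYPOTHESES; nothing about their truth is asserted and BSD is not proved by any of this.

WHAT. The lead's assembly `mazurTateCongruenceAtTwoTop_of_facts (PUB⁶) (HΔ) (Hμ)` (`…RAssembly`, p619635) proves the crux BY NAME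
from six named facts of the plus line and TWO explicit hypotheses: the habitat lemma `HΔ` («`Δ_W < 0` on the theta habitat») and
the symbol-`μ` statement `Hμ` («for every globally minimal `E` good supersingular at `2` with `a₂(E) = 0`, newform `f`, Néron ratio
`ϖ` (`ϖ·Ω_E = Ω⁺_f`) and `S₀` off `2`, the expanded `S₀`-depleted plus table `Ψ^{S₀}_E` attains its maximal `2`-adic size over `ℚ` at a
point `x₀` with `‖2ϖΨ^{S₀}_E(x₀)‖ = 1`»). This file discharges both modulo NAMED statements only:

* §1 `exists_depletedMax_eq_of_undepletedMax` — POINTWISE form (any `E` good supersingular at `2` with `a₂ = 0`; no CM / rank /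
  discriminant binders, so it serves the CM partner `A` as well as `W`) of rtt-p3-w3 g4's λ-room un-depletion
  `ThetaLayerLambdaCongruenceAtTwo.curveDepletedSymbolMaxAtTwoPowerCusp_of_undepleted` (`…MuW1OfUndepleted`, p607312), with the value
  of the maximum exported: if the UNDEPLETED plus symbol `[·]⁺_f` is maximal over `ℚ` at an even-layer `2`-power cusp, with maximum
  `V`, then for every `S₀` off `2` the DEPLETED table is maximal over `ℚ` at some even-layer `2`-power cusp WITH THE SAME VALUE `V`
  (proof = theirs verbatim: three-term monotonicity, `λ`-growth law, bounded `λ` of the layer Euler product, `λ`-room).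
* §2 `symbolMu_of_cuspSpanEvenAtTwo` — `Hμ(E)` at one curve from `CuspSpanEvenAtTwo N_E` + `realPeriodRat_eq_unit_mul_plusPeriod_two`:
  `CuspSpanEvenAtTwo N_E` ⟹ (PR₂) (`undepletedMax_of_cuspSpanEvenAtTwo`, rtt-p3-w3 g4); the maximum is `V = 2` (`≥`: the Manin cusp
  value `[γ∞]⁺_f = 1/2`, `exists_ratPlusSymbol_maninCusp_eq_one_half`; `≤`: `norm_ratPlusSymbol_le_two`); §1 puts the depleted maximum
  at some `x₀` with `‖Ψ(x₀)‖ = 2`; `‖ϖ‖₂ = 1` (`norm_ratCast_periodRatio_eq_one_two`, from the period fact) gives `‖2ϖΨ(x₀)‖ = 1`.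
  The admissibility binder `bad(E) ⊆ S₀` of `Hμ` is not used. `symbolMu_of_forall_cuspSpanEvenAtTwo` — `Hμ` VERBATIM (the lead's
  `∀ E` shape) from the period fact + `CuspSpanEvenAtTwo` at every odd level.
* §3 `mazurTateCongruenceAtTwoTop_of_facts_cuspSpan` — THE CRUX BY NAME from PUB⁶ + `realPeriodRat_eq_unit_mul_plusPeriod_two` +
  «`∀ N` odd, `CuspSpanEvenAtTwo N`»: `HΔ` := `ThetaPartnerXRoute.Δ_neg_of_cmPartner_two` (tree theorem: `A` CM and good
  supersingular at `2` ⇒ `Δ_A < 0` ⇒ `Δ_W < 0` through the equivariant `W[2] ≃ A[2]`), `Hμ` := §2. `…_of_facts_pairing_cuspSpan` —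
  the same with Hecke self-duality DERIVED from the integral intersection-pairing fact (`heckeSelfDual_torsionBy_J0_of_perfectPairing`,
  w2 g0-0, p619094). `…R_of_facts_cuspSpan` — the twin 21416. NET: crux 25797 (= 21416) rests, in the kernel and by name, on SEVEN
  named Literature facts plus ONE conjecture-grade, curve-free, finite-per-level research node — the SAME node behind crux Kan⁺
  (`ThetaLayerLambdaCongruenceAtTwo`, stmt-20688: `thetaLayerLambdaCongruenceAtTwo_of_facts_cuspSpan_deligne`) and Kμ⁺'s analytic half
  (stmt-21437: `SignedMuAtTwo.flatMuZeroAtTwo_of_forall_cuspSpanEvenAtTwo`) of route ResidualThetaTransportAtTwo.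

References: [GreenbergVatsal2000] §1 (8)/(10), Thm. (1.4), §2 Prop. (2.4), §3 (13) and Remark 3.4; [Vatsal1999] Thm. (1.13);
[PollackWeston2011MT] §3.1, Thm. 4.1, Rem. 4.2; [Pollack2003] Conj. 6.3; [AbbesUllmo1996] Thm. A; [Buzzard2000LevelLoweringModTwo]
Prop. 2.4; [CremonaAlgorithms1997] §2.8.
-/

-- justification: the `Summit.BirchSwinnertonDyer.BirchSwinnertonDyer.…` path repeats a component (route-file convention)
set_option linter.dupNamespace false
set_option autoImplicit false

noncomputable section

open scoped Classical MatrixGroups ModularForm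

open CongruenceSubgroup Polynomial WeierstrassCurve NumberField IsDedekindDomain
  Literature.NumberTheory.IwasawaTheory Literature.NumberTheory.EllipticCurves Literature.NumberTheory.EllipticCurves.ModularForms
  Literature.NumberTheory.EllipticCurves.Rank1Residual Literature.NumberTheory.EllipticCurves.GreenbergVatsal2000
  Summit.BirchSwinnertonDyer.Rank1Residual.Supersingular
  Summit.BirchSwinnertonDyer.BirchSwinnertonDyer.Theorems.ThetaLayerLambdaCongruenceAtTwo

namespace Summit.BirchSwinnertonDyer.BirchSwinnertonDyer.Theorems.MazurTateCongruenceAtTwoR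

/-! ## §1. Pointwise λ-room un-depletion: the depleted table attains the undepleted maximum -/

section Undepletion

variable (W : WeierstrassCurve ℚ) [W.IsElliptic] [W.IsGloballyMinimal]

/-- **Pointwise un-depletion (λ-room), with the value of the maximum.** For ANY globally minimal elliptic `W` good supersingular at
`2` with `a₂(W) = 0` (no CM / rank / discriminant hypothesis), its newform `f`, and a set `S₀` of odd places: if the UNDEPLETED
`2`-adic rational plus symbol `[·]⁺_f` attains its maximum norm `V` over `ℚ` at the `2`-power cusp `γ^{s₁}/2^{n₁+2}` of an EVEN layer
`n₁`, then the expanded `S₀`-DEPLETED plus table `Ψ^{S₀}_W` attains its maximum norm over `ℚ` at a `2`-power cusp `γ^s/2^{n+2}` of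
some even layer `n`, AND that maximum equals `V`. Proof verbatim after rtt-p3-w3 g4's `curveDepletedSymbolMaxAtTwoPowerCusp_of_undepleted`
(`…MuW1OfUndepleted`): every depleted value is `≤ V` (integral depletion coefficients); `‖θ_n(f)‖_sup = ‖2‖V` from `n₁` on (three-term
monotonicity at `a₂ = 0`), so the `λ`-growth law holds; the layer Euler product is non-zero of sup norm `1` with bounded `λ`; by
`λ`-room some layer `n = n₁ + 2k` has `‖Θ^{S₀}_n(W)‖_sup = ‖2‖V`, i.e. a depleted layer-`n` symbol of norm `V`.
[cite: PollackWeston2011MT, §3.1, Thm. 4.1 and Rem. 4.2.1 (λ(θ_n) = q_n + λ^± under μ^± = 0; read at p = 2)]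
[cite: GreenbergVatsal2000, §2 Prop. (2.4) (imprimitive elements: μ unchanged, λ shifts by the Euler factors)] -/
theorem exists_depletedMax_eq_of_undepletedMax (hss : GoodSS W 2) (ha : W.frobeniusTrace 2 = 0)
    [NeZero (W.conductorNorm ℤ)] {f : CuspForm (Gamma0 (W.conductorNorm ℤ)) 2} (hf : IsNewformOf W f)
    {n₁ : ℕ} (hn₁e : Even n₁) {s₁ : ZMod (2 ^ n₁)}
    (hmax : ∀ r : ℚ, ‖algebraMap ℚ (PadicAlgCl 2) (ratPlusSymbol f r)‖ ≤
      ‖algebraMap ℚ (PadicAlgCl 2) (ratPlusSymbol f ((((cyclotomicGenerator 2 : ZMod (2 ^ (n₁ + 2))) ^ s₁.val).val : ℚ) / (2 : ℚ) ^ (n₁ + 2)))‖)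
    (S₀ : Finset (HeightOneSpectrum (𝓞 ℚ))) (hS2 : ∀ v ∈ S₀, ((2 : ℕ) : 𝓞 ℚ) ∉ v.asIdeal) :
    ∃ n : ℕ, Even n ∧ ∃ s : ZMod (2 ^ n),
      (∀ r : ℚ, ‖(∑ k ∈ Fintype.piFinset (fun _ : S₀ ↦ Finset.range 3), (∏ v : S₀, ((W.localPolynomialAt (v : HeightOneSpectrum (𝓞 ℚ))).map (Int.castRingHom (PadicAlgCl 2))).coeff (k v) * ((Rat.HeightOneSpectrum.natGenerator (v : HeightOneSpectrum (𝓞 ℚ)) : PadicAlgCl 2)⁻¹) ^ (k v)) * algebraMap ℚ (PadicAlgCl 2) (ratPlusSymbol f (r * ((∏ v : S₀, Rat.HeightOneSpectrum.natGenerator (v : HeightOneSpectrum (𝓞 ℚ)) ^ (k v) : ℕ) : ℚ))))‖ ≤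
        ‖(∑ k ∈ Fintype.piFinset (fun _ : S₀ ↦ Finset.range 3), (∏ v : S₀, ((W.localPolynomialAt (v : HeightOneSpectrum (𝓞 ℚ))).map (Int.castRingHom (PadicAlgCl 2))).coeff (k v) * ((Rat.HeightOneSpectrum.natGenerator (v : HeightOneSpectrum (𝓞 ℚ)) : PadicAlgCl 2)⁻¹) ^ (k v)) * algebraMap ℚ (PadicAlgCl 2) (ratPlusSymbol f ((((((cyclotomicGenerator 2 : ZMod (2 ^ (n + 2))) ^ s.val).val : ℚ) / (2 : ℚ) ^ (n + 2))) * ((∏ v : S₀, Rat.HeightOneSpectrum.natGenerator (v : HeightOneSpectrum (𝓞 ℚ)) ^ (k v) : ℕ) : ℚ))))‖) ∧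
      ‖(∑ k ∈ Fintype.piFinset (fun _ : S₀ ↦ Finset.range 3), (∏ v : S₀, ((W.localPolynomialAt (v : HeightOneSpectrum (𝓞 ℚ))).map (Int.castRingHom (PadicAlgCl 2))).coeff (k v) * ((Rat.HeightOneSpectrum.natGenerator (v : HeightOneSpectrum (𝓞 ℚ)) : PadicAlgCl 2)⁻¹) ^ (k v)) * algebraMap ℚ (PadicAlgCl 2) (ratPlusSymbol f ((((((cyclotomicGenerator 2 : ZMod (2 ^ (n + 2))) ^ s.val).val : ℚ) / (2 : ℚ) ^ (n + 2))) * ((∏ v : S₀, Rat.HeightOneSpectrum.natGenerator (v : HeightOneSpectrum (𝓞 ℚ)) ^ (k v) : ℕ) : ℚ))))‖ =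
        ‖algebraMap ℚ (PadicAlgCl 2) (ratPlusSymbol f ((((cyclotomicGenerator 2 : ZMod (2 ^ (n₁ + 2))) ^ s₁.val).val : ℚ) / (2 : ℚ) ^ (n₁ + 2)))‖ := by
  -- adapted (pointwise, value exported) from `ThetaLayerLambdaCongruenceAtTwo.curveDepletedSymbolMaxAtTwoPowerCusp_of_undepleted`
  haveI : NeZero (2 ^ n₁) := ⟨pow_ne_zero _ two_ne_zero⟩
  -- the maximum `V` of the undepleted symbol
  set V : ℝ := ‖algebraMap ℚ (PadicAlgCl 2) (ratPlusSymbol f ((((cyclotomicGenerator 2 : ZMod (2 ^ (n₁ + 2))) ^ s₁.val).val : ℚ) / (2 : ℚ) ^ (n₁ + 2)))‖ with hVdef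
  have hbound : ∀ (x : ℚ), ‖(∑ k ∈ Fintype.piFinset (fun _ : S₀ ↦ Finset.range 3), (∏ v : S₀, ((W.localPolynomialAt (v : HeightOneSpectrum (𝓞 ℚ))).map (Int.castRingHom (PadicAlgCl 2))).coeff (k v) * ((Rat.HeightOneSpectrum.natGenerator (v : HeightOneSpectrum (𝓞 ℚ)) : PadicAlgCl 2)⁻¹) ^ (k v)) * algebraMap ℚ (PadicAlgCl 2) (ratPlusSymbol f (x * ((∏ v : S₀, Rat.HeightOneSpectrum.natGenerator (v : HeightOneSpectrum (𝓞 ℚ)) ^ (k v) : ℕ) : ℚ))))‖ ≤ V := fun x ↦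
    norm_depletedCurveSymbol_le_of_forall_le W f S₀ hS2 hmax x
  rcases (norm_nonneg (algebraMap ℚ (PadicAlgCl 2) (ratPlusSymbol f ((((cyclotomicGenerator 2 : ZMod (2 ^ (n₁ + 2))) ^ s₁.val).val : ℚ) / (2 : ℚ) ^ (n₁ + 2))))).eq_or_lt with hV0 | hVpos
  · -- degenerate case: the undepleted symbol vanishes identically, hence so does the depleted one
    refine ⟨n₁, hn₁e, s₁, fun r ↦ ?_, ?_⟩
    · exact ((hbound r).trans_eq hV0.symm).trans (norm_nonneg _)
    · exact le_antisymm (hbound _) (hV0.symm.trans_le (norm_nonneg _))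
  · have h2pos : 0 < ‖(2 : PadicAlgCl 2)‖ := norm_pos_iff.mpr two_ne_zero
    -- (1) the undepleted element `U n = θ_n(f)^alg` is `C 2 ·` the layer sum of the undepleted symbols
    have hU : ∀ n : ℕ, (((mazurTateElement f 2 (n)).map (algebraMap ℚ (PadicAlgCl 2)))).supNorm = ‖(2 : PadicAlgCl 2)‖ * (∑ s : ZMod (2 ^ (n)), Polynomial.C (algebraMap ℚ (PadicAlgCl 2) (ratPlusSymbol f ((((cyclotomicGenerator 2 : ZMod (2 ^ (n + 2))) ^ s.val).val : ℚ) / (2 : ℚ) ^ (n + 2)))) * (Polynomial.X + 1) ^ s.val).supNorm := fun n ↦ by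
      rw [map_mazurTateElement_two f n, supNorm_C_mul]
    -- (2) `‖U n‖_sup ≤ ‖2‖·V` for every `n`, with equality at `n₁`
    have hUle : ∀ n : ℕ, (((mazurTateElement f 2 (n)).map (algebraMap ℚ (PadicAlgCl 2)))).supNorm ≤ ‖(2 : PadicAlgCl 2)‖ * V := fun n ↦ by
      haveI : NeZero (2 ^ n) := ⟨pow_ne_zero _ two_ne_zero⟩
      rw [hU n]
      refine mul_le_mul_of_nonneg_left ?_ (norm_nonneg _)
      exact (supNorm_sum_C_mul_X_add_one_pow_le_iff
        (fun s : ZMod (2 ^ n) ↦ algebraMap ℚ (PadicAlgCl 2) (ratPlusSymbol f ((((cyclotomicGenerator 2 : ZMod (2 ^ (n + 2))) ^ s.val).val : ℚ) / (2 : ℚ) ^ (n + 2)))) hVpos.le).mpr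
        fun t ↦ hmax _
    have hU₁ : (((mazurTateElement f 2 (n₁)).map (algebraMap ℚ (PadicAlgCl 2)))).supNorm = ‖(2 : PadicAlgCl 2)‖ * V := by
      refine le_antisymm (hUle n₁) ?_
      rw [hU n₁]
      exact mul_le_mul_of_nonneg_left (norm_le_supNorm_sum_C_mul_X_add_one_pow
        (fun s : ZMod (2 ^ n₁) ↦ algebraMap ℚ (PadicAlgCl 2) (ratPlusSymbol f ((((cyclotomicGenerator 2 : ZMod (2 ^ (n₁ + 2))) ^ s.val).val : ℚ) / (2 : ℚ) ^ (n₁ + 2)))) s₁) (norm_nonneg _)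
    have hU0 : ((mazurTateElement f 2 (n₁)).map (algebraMap ℚ (PadicAlgCl 2))) ≠ 0 := fun h ↦ by
      have h' := hU₁
      rw [h, supNorm_zero] at h'
      exact (mul_pos h2pos hVpos).ne h'
    -- (3) the crux's `W`-element at `S₀ = ∅` IS `U n`
    have hDempty : ∀ n : ℕ, ((((mazurTateElement f 2 (n)).map (algebraMap ℚ (PadicAlgCl 2))) * ∏ v ∈ (∅ : Finset (HeightOneSpectrum (𝓞 ℚ))), ((W.localPolynomialAt v).map (Int.castRingHom (PadicAlgCl 2))).comp (Polynomial.C ((Rat.HeightOneSpectrum.natGenerator v : PadicAlgCl 2)⁻¹) * (Polynomial.X + 1) ^ (PadicInt.toZModPow (n) (-(frobeniusExponent 2 (Rat.HeightOneSpectrum.natGenerator v : ℤ_[2])))).val)) %ₘ ((Polynomial.X + 1) ^ 2 ^ (n) - 1)) = ((mazurTateElement f 2 (n)).map (algebraMap ℚ (PadicAlgCl 2))) := fun n ↦ by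
      rw [Finset.prod_empty, mul_one, map_mazurTateElement_two f n, C_mul', smul_modByMonic]
      have hfix := layerSum_modByMonic_layerModulus (K := PadicAlgCl 2)
        (fun t : ℕ ↦ algebraMap ℚ (PadicAlgCl 2) (ratPlusSymbol f ((((cyclotomicGenerator 2 : ZMod (2 ^ (n + 2))) ^ t).val : ℚ) / (2 : ℚ) ^ (n + 2)))) n
      beta_reduce at hfix
      rw [hfix]
    -- (4) monotonicity along the even layers (three-term relation, `S₀ = ∅` instance) ⟹ constancy at `‖2‖·V` from `n₁`
    have hmono : ∀ n : ℕ, (((mazurTateElement f 2 (n)).map (algebraMap ℚ (PadicAlgCl 2)))).supNorm ≤ (((mazurTateElement f 2 (n + 2)).map (algebraMap ℚ (PadicAlgCl 2)))).supNorm := fun n ↦ by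
      have h := wSide_supNorm_le_add_two (∅ : Finset (HeightOneSpectrum (𝓞 ℚ))) hss ha hf n
      rwa [hDempty n, hDempty (n + 2)] at h
    have hUk : ∀ k : ℕ, (((mazurTateElement f 2 (n₁ + 2 * k)).map (algebraMap ℚ (PadicAlgCl 2)))).supNorm = ‖(2 : PadicAlgCl 2)‖ * V := by
      intro k
      induction k with
      | zero => simpa using hU₁
      | succ k ih =>
        refine le_antisymm (hUle _) ?_
        have e : n₁ + 2 * (k + 1) = n₁ + 2 * k + 2 := by ring
        rw [e, ← ih]
        exact hmono _
    -- (5) the `λ`-growth law from `n₁` (stabilised at the maximum), `S₀ = ∅` instance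
    have hgrowth : ∀ k : ℕ, 3 * layerLambda ((mazurTateElement f 2 (n₁ + 2 * k)).map (algebraMap ℚ (PadicAlgCl 2))) + 2 ^ n₁ =
        3 * layerLambda ((mazurTateElement f 2 (n₁)).map (algebraMap ℚ (PadicAlgCl 2))) + 2 ^ n₁ * 4 ^ k := by
      intro k
      have h0' : ((((mazurTateElement f 2 (n₁)).map (algebraMap ℚ (PadicAlgCl 2))) * ∏ v ∈ (∅ : Finset (HeightOneSpectrum (𝓞 ℚ))), ((W.localPolynomialAt v).map (Int.castRingHom (PadicAlgCl 2))).comp (Polynomial.C ((Rat.HeightOneSpectrum.natGenerator v : PadicAlgCl 2)⁻¹) * (Polynomial.X + 1) ^ (PadicInt.toZModPow (n₁) (-(frobeniusExponent 2 (Rat.HeightOneSpectrum.natGenerator v : ℤ_[2])))).val)) %ₘ ((Polynomial.X + 1) ^ 2 ^ (n₁) - 1)) ≠ 0 := by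
        rw [hDempty n₁]; exact hU0
      have hst' : ∀ k : ℕ, (((((mazurTateElement f 2 (n₁ + 2 * k + 2)).map (algebraMap ℚ (PadicAlgCl 2))) * ∏ v ∈ (∅ : Finset (HeightOneSpectrum (𝓞 ℚ))), ((W.localPolynomialAt v).map (Int.castRingHom (PadicAlgCl 2))).comp (Polynomial.C ((Rat.HeightOneSpectrum.natGenerator v : PadicAlgCl 2)⁻¹) * (Polynomial.X + 1) ^ (PadicInt.toZModPow (n₁ + 2 * k + 2) (-(frobeniusExponent 2 (Rat.HeightOneSpectrum.natGenerator v : ℤ_[2])))).val)) %ₘ ((Polynomial.X + 1) ^ 2 ^ (n₁ + 2 * k + 2) - 1))).supNorm ≤ (((((mazurTateElement f 2 (n₁ + 2 * k)).map (algebraMap ℚ (PadicAlgCl 2))) * ∏ v ∈ (∅ : Finset (HeightOneSpectrum (𝓞 ℚ))), ((W.localPolynomialAt v).map (Int.castRingHom (PadicAlgCl 2))).comp (Polynomial.C ((Rat.HeightOneSpectrum.natGenerator v : PadicAlgCl 2)⁻¹) * (Polynomial.X + 1) ^ (PadicInt.toZModPow (n₁ + 2 * k) (-(frobeniusExponent 2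 (Rat.HeightOneSpectrum.natGenerator v : ℤ_[2])))).val)) %ₘ ((Polynomial.X + 1) ^ 2 ^ (n₁ + 2 * k) - 1))).supNorm := fun k ↦ by
        have e : n₁ + 2 * k + 2 = n₁ + 2 * (k + 1) := by ring
        rw [hDempty, hDempty, e, hUk, hUk]
      have hg := wSide_growth_mul_of_stabilized (∅ : Finset (HeightOneSpectrum (𝓞 ℚ))) hss ha hf h0' hst' k
      rwa [hDempty, hDempty] at hg
    -- (6) `λ(U n₁) < 2^{n₁}` (degree `< 2^{n₁}`)
    have hlam₁ : layerLambda ((mazurTateElement f 2 (n₁)).map (algebraMap ℚ (PadicAlgCl 2))) < 2 ^ n₁ := by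
      refine lt_of_le_of_lt (layerLambda_le_natDegree hU0) ?_
      have hdeg := natDegree_layerSum_lt (K := PadicAlgCl 2)
        (fun t : ℕ ↦ algebraMap ℚ (PadicAlgCl 2) (ratPlusSymbol f ((((cyclotomicGenerator 2 : ZMod (2 ^ (n₁ + 2))) ^ t).val : ℚ) / (2 : ℚ) ^ (n₁ + 2)))) n₁
      beta_reduce at hdeg
      rw [map_mazurTateElement_two f n₁]
      exact lt_of_le_of_lt (natDegree_C_mul_le _ _) hdeg
    -- (7) the layer Euler product: non-zero, sup norm `1`, bounded `λ`
    have hE : ∀ n : ℕ, S₀.sup (fun v ↦ padicValNat 2 ((Rat.HeightOneSpectrum.natGenerator v ^ 2 - 1) / 8)) + 1 ≤ n →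
        (∏ v ∈ S₀, ((W.localPolynomialAt v).map (Int.castRingHom (PadicAlgCl 2))).comp (Polynomial.C ((Rat.HeightOneSpectrum.natGenerator v : PadicAlgCl 2)⁻¹) * (Polynomial.X + 1) ^ (PadicInt.toZModPow (n) (-(frobeniusExponent 2 (Rat.HeightOneSpectrum.natGenerator v : ℤ_[2])))).val)) ≠ 0 ∧ ((∏ v ∈ S₀, ((W.localPolynomialAt v).map (Int.castRingHom (PadicAlgCl 2))).comp (Polynomial.C ((Rat.HeightOneSpectrum.natGenerator v : PadicAlgCl 2)⁻¹) * (Polynomial.X + 1) ^ (PadicInt.toZModPow (n) (-(frobeniusExponent 2 (Rat.HeightOneSpectrum.natGenerator v : ℤ_[2])))).val))).supNorm = 1 ∧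
        layerLambda (∏ v ∈ S₀, ((W.localPolynomialAt v).map (Int.castRingHom (PadicAlgCl 2))).comp (Polynomial.C ((Rat.HeightOneSpectrum.natGenerator v : PadicAlgCl 2)⁻¹) * (Polynomial.X + 1) ^ (PadicInt.toZModPow (n) (-(frobeniusExponent 2 (Rat.HeightOneSpectrum.natGenerator v : ℤ_[2])))).val)) ≤ ∑ v ∈ S₀, 2 ^ (padicValNat 2 ((Rat.HeightOneSpectrum.natGenerator v ^ 2 - 1) / 8) + 1) :=
      fun n hn ↦ wEulerProduct_layer_facts W S₀ hS2 (by omega)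
    -- (8) `λ`-room: some even layer `n = n₁ + 2k` at which the depleted element has full sup norm `‖2‖·V`
    obtain ⟨j, -, hj⟩ := exists_supNorm_modByMonic_mul_eq_of_growth
      (θ := fun n ↦ ((mazurTateElement f 2 (n)).map (algebraMap ℚ (PadicAlgCl 2)))) (E := fun n ↦ (∏ v ∈ S₀, ((W.localPolynomialAt v).map (Int.castRingHom (PadicAlgCl 2))).comp (Polynomial.C ((Rat.HeightOneSpectrum.natGenerator v : PadicAlgCl 2)⁻¹) * (Polynomial.X + 1) ^ (PadicInt.toZModPow (n) (-(frobeniusExponent 2 (Rat.HeightOneSpectrum.natGenerator v : ℤ_[2])))).val))) (mul_pos h2pos hVpos) hUk hlam₁ hgrowth hE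
    -- (9) read the depleted element as `C 2 ·` the layer sum of the DEPLETED symbols
    haveI : NeZero (2 ^ (n₁ + 2 * j)) := ⟨pow_ne_zero _ two_ne_zero⟩
    rw [depletedCurveLayer_eq_layerSum_depletedSymbol f W (n₁ + 2 * j) S₀ hS2, supNorm_C_mul] at hj
    have hj' := mul_left_cancel₀ h2pos.ne' hj
    obtain ⟨s, hs⟩ := exists_supNorm_sum_C_mul_X_add_one_pow_eq
      (fun s : ZMod (2 ^ (n₁ + 2 * j)) ↦ (∑ k ∈ Fintype.piFinset (fun _ : S₀ ↦ Finset.range 3), (∏ v : S₀, ((W.localPolynomialAt (v : HeightOneSpectrum (𝓞 ℚ))).map (Int.castRingHom (PadicAlgCl 2))).coeff (k v) * ((Rat.HeightOneSpectrum.natGenerator (v : HeightOneSpectrum (𝓞 ℚ)) : PadicAlgCl 2)⁻¹) ^ (k v)) * algebraMap ℚ (PadicAlgCl 2) (ratPlusSymbol f ((((((cyclotomicGenerator 2 : ZMod (2 ^ (n₁ + 2 * j + 2))) ^ s.val).val : ℚ) / (2 : ℚ) ^ (n₁ + 2 * j + 2))) * ((∏ v : S₀, Rat.HeightOneSpectrum.natGenerator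 (v : HeightOneSpectrum (𝓞 ℚ)) ^ (k v) : ℕ) : ℚ)))))
    have hval : ‖(∑ k ∈ Fintype.piFinset (fun _ : S₀ ↦ Finset.range 3), (∏ v : S₀, ((W.localPolynomialAt (v : HeightOneSpectrum (𝓞 ℚ))).map (Int.castRingHom (PadicAlgCl 2))).coeff (k v) * ((Rat.HeightOneSpectrum.natGenerator (v : HeightOneSpectrum (𝓞 ℚ)) : PadicAlgCl 2)⁻¹) ^ (k v)) * algebraMap ℚ (PadicAlgCl 2) (ratPlusSymbol f ((((((cyclotomicGenerator 2 : ZMod (2 ^ (n₁ + 2 * j + 2))) ^ s.val).val : ℚ) / (2 : ℚ) ^ (n₁ + 2 * j + 2))) * ((∏ v : S₀, Rat.HeightOneSpectrum.natGenerator (v : HeightOneSpectrum (𝓞 ℚ)) ^ (k v) : ℕ) : ℚ))))‖ = V := by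
      rw [← hs]; exact hj'
    refine ⟨n₁ + 2 * j, hn₁e.add (even_two_mul j), s, fun r ↦ ?_, hval⟩
    rw [hval]
    exact hbound r

end Undepletion

/-! ## §2. The symbol-`μ` statement `Hμ` from `CuspSpanEvenAtTwo` and the period fact -/

section SymbolMu

variable (E : WeierstrassCurve ℚ) [E.IsElliptic] [E.IsGloballyMinimal]

/-- **`Hμ(E)` from the curve-free node.** For a globally minimal elliptic `E` good supersingular at `2` with `a₂(E) = 0`, its newform
`f`, a rational `ϖ` with `ϖ·Ω_E = Ω⁺_f` and a finite set `S₀` of odd places: granted the period fact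
`realPeriodRat_eq_unit_mul_plusPeriod_two` (so `‖ϖ‖₂ = 1`) and `SignedMuAtTwo.CuspSpanEvenAtTwo N_E`, the expanded `S₀`-depleted plus
table `Ψ^{S₀}_E` attains its maximal `2`-adic norm over `ℚ` at some `x₀` with `‖2ϖ·Ψ^{S₀}_E(x₀)‖ = 1` — i.e. the doubled
Néron-normalised depleted plus symbol is `2`-integral on `ℚ` and primitive («symbol `μ = 0` at `2`»). (PR₂) from the node
(`undepletedMax_of_cuspSpanEvenAtTwo`); maximum `= 2` (Manin cusp `1/2` and `norm_ratPlusSymbol_le_two`); un-depletion §1.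
[cite: Pollack2003, Conj. 6.3 (μ^± = 0)] [cite: PollackWeston2011MT, Rem. 4.2.1] [cite: GreenbergVatsal2000, §3, Remark 3.4] -/
theorem symbolMu_of_cuspSpanEvenAtTwo (h2 : realPeriodRat_eq_unit_mul_plusPeriod_two) (hss : GoodSS E 2)
    (ha : E.frobeniusTrace 2 = 0) [NeZero (E.conductorNorm ℤ)] {f : CuspForm (Gamma0 (E.conductorNorm ℤ)) 2} (hf : IsNewformOf E f)
    {ϖ : ℚ} (hϖ : (ϖ : ℝ) * E.realPeriodRat = plusPeriod f)
    (S₀ : Finset (HeightOneSpectrum (𝓞 ℚ))) (hS2 : ∀ v ∈ S₀, ((2 : ℕ) : 𝓞 ℚ) ∉ v.asIdeal)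
    (hG : SignedMuAtTwo.CuspSpanEvenAtTwo (E.conductorNorm ℤ)) :
    ∃ x₀ : ℚ, (∀ r : ℚ, ‖(∑ k ∈ Fintype.piFinset (fun _ : S₀ ↦ Finset.range 3), (∏ v : S₀, ((E.localPolynomialAt (v : HeightOneSpectrum (𝓞 ℚ))).map (Int.castRingHom (PadicAlgCl 2))).coeff (k v) * ((Rat.HeightOneSpectrum.natGenerator (v : HeightOneSpectrum (𝓞 ℚ)) : PadicAlgCl 2)⁻¹) ^ (k v)) * algebraMap ℚ (PadicAlgCl 2) (ratPlusSymbol f (r * ((∏ v : S₀, Rat.HeightOneSpectrum.natGenerator (v : HeightOneSpectrum (𝓞 ℚ)) ^ (k v) : ℕ) : ℚ))))‖ ≤ ‖(∑ k ∈ Fintype.piFinset (fun _ : S₀ ↦ Finset.range 3), (∏ v : S₀, ((E.localPolynomialAt (v : HeightOneSpectrum (𝓞 ℚ))).map (Int.castRingHom (PadicAlgCl 2))).coeff (k v) * ((Rat.HeightOneSpectrum.natGenerator (v : HeightOneSpectrum (𝓞 ℚ)) : PadicAlgCl 2)⁻¹) ^ (k v)) * algebraMap ℚ (PadicAlgCl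 2) (ratPlusSymbol f (x₀ * ((∏ v : S₀, Rat.HeightOneSpectrum.natGenerator (v : HeightOneSpectrum (𝓞 ℚ)) ^ (k v) : ℕ) : ℚ))))‖) ∧
      ‖algebraMap ℚ (PadicAlgCl 2) (2 * ϖ) * (∑ k ∈ Fintype.piFinset (fun _ : S₀ ↦ Finset.range 3), (∏ v : S₀, ((E.localPolynomialAt (v : HeightOneSpectrum (𝓞 ℚ))).map (Int.castRingHom (PadicAlgCl 2))).coeff (k v) * ((Rat.HeightOneSpectrum.natGenerator (v : HeightOneSpectrum (𝓞 ℚ)) : PadicAlgCl 2)⁻¹) ^ (k v)) * algebraMap ℚ (PadicAlgCl 2) (ratPlusSymbol f (x₀ * ((∏ v : S₀, Rat.HeightOneSpectrum.natGenerator (v : HeightOneSpectrum (𝓞 ℚ)) ^ (k v) : ℕ) : ℚ))))‖ = 1 := by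
  -- (PR₂) at `(E, f)` from the node
  obtain ⟨n₁, hn₁, s₁, hmax⟩ := undepletedMax_of_cuspSpanEvenAtTwo hf hss ha hG
  -- the undepleted maximum is exactly `2`
  have hV : ‖algebraMap ℚ (PadicAlgCl 2) (ratPlusSymbol f ((((cyclotomicGenerator 2 : ZMod (2 ^ (n₁ + 2))) ^ s₁.val).val : ℚ) / (2 : ℚ) ^ (n₁ + 2)))‖ = 2 := by
    refine le_antisymm (norm_ratPlusSymbol_le_two hf hss ha _) ?_
    obtain ⟨γ, -, hγ⟩ := exists_ratPlusSymbol_maninCusp_eq_one_half f hf.1 hf.coeffField_eq_bot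
    refine le_trans (le_of_eq ?_) (hmax ((((γ : SL(2, ℤ)) 0 0 : ℚ)) / (((γ : SL(2, ℤ)) 1 0 : ℚ))))
    rw [hγ, one_div, map_inv₀, map_ofNat, norm_inv, ResidualThetaLayer.norm_two_padicAlgCl, inv_inv]
  -- un-depletion (§1): the depleted maximum, of the same value `2`
  obtain ⟨n, -, s, hle, hval⟩ := exists_depletedMax_eq_of_undepletedMax E hss ha hf hn₁ hmax S₀ hS2
  rw [hV] at hval
  refine ⟨(((cyclotomicGenerator 2 : ZMod (2 ^ (n + 2))) ^ s.val).val : ℚ) / (2 : ℚ) ^ (n + 2), hle, ?_⟩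
  -- `‖2ϖ‖ · 2 = 1`
  have hϖ1 : ‖algebraMap ℚ (PadicAlgCl 2) ϖ‖ = 1 := by
    rw [norm_algebraMap_rat_eq_norm_ratCast_padic]
    exact norm_ratCast_periodRatio_eq_one_two h2 E hss hf hϖ
  rw [norm_mul, hval, map_mul, norm_mul, hϖ1, map_ofNat, ResidualThetaLayer.norm_two_padicAlgCl]
  norm_num

/-- **`Hμ` VERBATIM** (the lead's `∀ E` shape, hypothesis of `mazurTateCongruenceAtTwoTop_of_facts`, `…RAssembly`) from the period fact
`realPeriodRat_eq_unit_mul_plusPeriod_two` and `SignedMuAtTwo.CuspSpanEvenAtTwo N` at every odd level (the conductor of a curve good at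
`2` is odd). The admissibility binder `bad(E) ⊆ S₀` is not used. [cite: Pollack2003, Conj. 6.3 (μ^± = 0)] [cite: GreenbergVatsal2000, §3, Remark 3.4] -/
theorem symbolMu_of_forall_cuspSpanEvenAtTwo (h2 : realPeriodRat_eq_unit_mul_plusPeriod_two)
    (hG : ∀ (N : ℕ) [NeZero N], ¬ 2 ∣ N → SignedMuAtTwo.CuspSpanEvenAtTwo N) :
    ∀ (E : WeierstrassCurve ℚ) [E.IsElliptic] [E.IsGloballyMinimal], GoodSS E 2 → E.frobeniusTrace 2 = 0 →
      ∀ [NeZero (E.conductorNorm ℤ)] (f : CuspForm (Gamma0 (E.conductorNorm ℤ)) 2), IsNewformOf E f →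
      ∀ (ϖ : ℚ), (ϖ : ℝ) * E.realPeriodRat = plusPeriod f →
      ∀ (S₀ : Finset (HeightOneSpectrum (𝓞 ℚ))), (∀ v ∈ S₀, ((2 : ℕ) : 𝓞 ℚ) ∉ v.asIdeal) →
        (∀ v : HeightOneSpectrum (𝓞 ℚ), ¬ E.HasGoodReductionAt v → v ∈ S₀) →
      ∃ x₀ : ℚ, (∀ r : ℚ, ‖(∑ k ∈ Fintype.piFinset (fun _ : S₀ ↦ Finset.range 3), (∏ v : S₀, ((E.localPolynomialAt (v : HeightOneSpectrum (𝓞 ℚ))).map (Int.castRingHom (PadicAlgCl 2))).coeff (k v) * ((Rat.HeightOneSpectrum.natGenerator (v : HeightOneSpectrum (𝓞 ℚ)) : PadicAlgCl 2)⁻¹) ^ (k v)) * algebraMap ℚ (PadicAlgCl 2) (ratPlusSymbol f (r * ((∏ v : S₀, Rat.HeightOneSpectrum.natGenerator (v : HeightOneSpectrum (𝓞 ℚ)) ^ (k v) : ℕ) : ℚ))))‖ ≤ ‖(∑ k ∈ Fintype.piFinset (fun _ : S₀ ↦ Finset.range 3), (∏ v : S₀, ((E.localPolynomialAt (v : HeightOneSpectrum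 (𝓞 ℚ))).map (Int.castRingHom (PadicAlgCl 2))).coeff (k v) * ((Rat.HeightOneSpectrum.natGenerator (v : HeightOneSpectrum (𝓞 ℚ)) : PadicAlgCl 2)⁻¹) ^ (k v)) * algebraMap ℚ (PadicAlgCl 2) (ratPlusSymbol f (x₀ * ((∏ v : S₀, Rat.HeightOneSpectrum.natGenerator (v : HeightOneSpectrum (𝓞 ℚ)) ^ (k v) : ℕ) : ℚ))))‖) ∧
        ‖algebraMap ℚ (PadicAlgCl 2) (2 * ϖ) * (∑ k ∈ Fintype.piFinset (fun _ : S₀ ↦ Finset.range 3), (∏ v : S₀, ((E.localPolynomialAt (v : HeightOneSpectrum (𝓞 ℚ))).map (Int.castRingHom (PadicAlgCl 2))).coeff (k v) * ((Rat.HeightOneSpectrum.natGenerator (v : HeightOneSpectrum (𝓞 ℚ)) : PadicAlgCl 2)⁻¹) ^ (k v)) * algebraMap ℚ (PadicAlgCl 2) (ratPlusSymbol f (x₀ * ((∏ v : S₀, Rat.HeightOneSpectrum.natGenerator (v : HeightOneSpectrum (𝓞 ℚ)) ^ (k v) : ℕ) : ℚ))))‖ = 1 := by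
  intro E _ _ hss ha _ f hf ϖ hϖ S₀ hS2 _
  exact symbolMu_of_cuspSpanEvenAtTwo E h2 hss ha hf hϖ S₀ hS2
    (hG _ (SignedMuAtTwo.not_two_dvd_conductorNorm_of_goodSS hss))

end SymbolMu

/-! ## §3. THE CRUX BY NAME behind seven named facts and the curve-free node -/

section Crux

/-- **The habitat lemma `HΔ` HOLDS** (hypothesis of `mazurTateCongruenceAtTwoTop_of_facts`): on the theta habitat — `A` with CM and good
supersingular at `2`, a Galois-equivariant `W[2] ≃+ A[2]` — one has `Δ_W < 0`; the binders `¬ W.HasCM`, `W.analyticRank = 0`,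
`GoodSS W 2`, `a₂(W) = 0`, `a₂(A) = 0` are not used. This is the tree theorem `ThetaPartnerXRoute.Δ_neg_of_cmPartner_two`
(`j(A) ∈` the thirteen CM values and `2`-supersingularity force `Δ_A < 0`; the sign of `Δ` is read on the `2`-torsion).
[cite: Serre1972, §5.1 (ℚ(√Δ) ⊂ ℚ(E[2]))] -/
theorem habitatNegDisc :
    ∀ (W : WeierstrassCurve ℚ) [W.IsElliptic] [W.IsGloballyMinimal] (A : WeierstrassCurve ℚ) [A.IsElliptic]
      [A.IsGloballyMinimal], ¬ W.HasCM → W.analyticRank = 0 → GoodSS W 2 → W.frobeniusTrace 2 = 0 → A.HasCM → GoodSS A 2 →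
      A.frobeniusTrace 2 = 0 →
      (∃ e : geomTorsion W (2 : ℤ) ≃+ geomTorsion A (2 : ℤ),
        ∀ (σ : Field.absoluteGaloisGroup ℚ) (P : geomTorsion W (2 : ℤ)), e (σ • P) = σ • e P) → W.Δ < 0 := by
  intro W _ _ A _ _ _ _ _ _ hAcm hAss _ he
  obtain ⟨e, he⟩ := he
  exact ThetaPartnerXRoute.Δ_neg_of_cmPartner_two W A hAcm hAss e he

/-- **`MazurTateCongruenceAtTwoTop` (crux stmt-25797; `=` 21416) BY NAME behind NAMED statements only.** Granted (i) the six named facts of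
the plus line (Eichler–Shimura for the depleted optimal quotient, Faltings, Mazur–Kenku, Hecke self-duality, Buzzard's mod-`2` multiplicity
one, Serre's supersingular image), (ii) the period fact `realPeriodRat_eq_unit_mul_plusPeriod_two` (Abbes–Ullmo Thm. A + Greenberg–Vatsal
Rem. 3.4: `Ω_E = u·Ω⁺_f`, `|u|₂ = 1`), and (iii) the curve-free research node `SignedMuAtTwo.CuspSpanEvenAtTwo N` of route
ResidualThetaTransportAtTwo at every odd level `N`, the crux holds: the lead's `mazurTateCongruenceAtTwoTop_of_facts` with `HΔ :=`
`habitatNegDisc` and `Hμ :=` `symbolMu_of_forall_cuspSpanEvenAtTwo`. The research content of K1 is thereby the SAME node as crux Kan⁺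
(stmt-20688) and the analytic half of Kμ⁺ (stmt-21437). BSD is not proved by this.
[cite: GreenbergVatsal2000, Thm. (1.4), §3 (13)] [cite: Vatsal1999, Thm. (1.13)] [cite: Pollack2003, Conj. 6.3] -/
theorem mazurTateCongruenceAtTwoTop_of_facts_cuspSpan
    (hES : eichlerShimura_depletedOptimalQuotient_periodLattice_of_dvd)
    (hF : WeierstrassCurve.isIsogenous_iff_frobeniusTrace_eq) (hMK : mazurKenku_exists_cyclic_isogeny)
    (hSD : heckeSelfDual_torsionBy_J0) (hBz : buzzard2000_multiplicityOne_gamma0)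
    (hSe : serre1972_supersingular_decompositionSubgroup_image)
    (h2 : realPeriodRat_eq_unit_mul_plusPeriod_two)
    (hG : ∀ (N : ℕ) [NeZero N], ¬ 2 ∣ N → SignedMuAtTwo.CuspSpanEvenAtTwo N) :
    Summit.BirchSwinnertonDyer.BirchSwinnertonDyer.Theses.ThetaPartnerAtTwo.MazurTateCongruenceAtTwoTop :=
  mazurTateCongruenceAtTwoTop_of_facts hES hF hMK hSD hBz hSe habitatNegDisc (symbolMu_of_forall_cuspSpanEvenAtTwo h2 hG)

/-- The same with Hecke self-duality `heckeSelfDual_torsionBy_J0` DERIVED from the integral intersection-pairing fact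
`periodHomology_exists_heckeSelfAdjoint_perfectPairing` (`heckeSelfDual_torsionBy_J0_of_perfectPairing`, Literature): the crux BY NAME
behind {Eichler–Shimura (depleted optimal quotient), Faltings, Mazur–Kenku, integral pairing, Buzzard, Serre 1972, period fact} +
«`∀ N` odd, `CuspSpanEvenAtTwo N`». BSD is not proved by this.
[cite: DarmonDiamondTaylor1995, §1.6 Lemma 1.38 and §4.5] [cite: GreenbergVatsal2000, Thm. (1.4), §3 (13)] -/
theorem mazurTateCongruenceAtTwoTop_of_facts_pairing_cuspSpan
    (hES : eichlerShimura_depletedOptimalQuotient_periodLattice_of_dvd)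
    (hF : WeierstrassCurve.isIsogenous_iff_frobeniusTrace_eq) (hMK : mazurKenku_exists_cyclic_isogeny)
    (hpair : periodHomology_exists_heckeSelfAdjoint_perfectPairing) (hBz : buzzard2000_multiplicityOne_gamma0)
    (hSe : serre1972_supersingular_decompositionSubgroup_image)
    (h2 : realPeriodRat_eq_unit_mul_plusPeriod_two)
    (hG : ∀ (N : ℕ) [NeZero N], ¬ 2 ∣ N → SignedMuAtTwo.CuspSpanEvenAtTwo N) :
    Summit.BirchSwinnertonDyer.BirchSwinnertonDyer.Theses.ThetaPartnerAtTwo.MazurTateCongruenceAtTwoTop :=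
  mazurTateCongruenceAtTwoTop_of_facts_cuspSpan hES hF hMK (heckeSelfDual_torsionBy_J0_of_perfectPairing hpair) hBz hSe h2 hG

/-- The twin `MazurTateCongruenceAtTwoR` (stmt-21416) BY NAME behind the same seven named facts + the node (definitionally the same
statement). BSD is not proved by this. [cite: GreenbergVatsal2000, Thm. (1.4), §3 (13)] -/
theorem mazurTateCongruenceAtTwoR_of_facts_cuspSpan
    (hES : eichlerShimura_depletedOptimalQuotient_periodLattice_of_dvd)
    (hF : WeierstrassCurve.isIsogenous_iff_frobeniusTrace_eq) (hMK : mazurKenku_exists_cyclic_isogeny)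
    (hSD : heckeSelfDual_torsionBy_J0) (hBz : buzzard2000_multiplicityOne_gamma0)
    (hSe : serre1972_supersingular_decompositionSubgroup_image)
    (h2 : realPeriodRat_eq_unit_mul_plusPeriod_two)
    (hG : ∀ (N : ℕ) [NeZero N], ¬ 2 ∣ N → SignedMuAtTwo.CuspSpanEvenAtTwo N) :
    Summit.BirchSwinnertonDyer.BirchSwinnertonDyer.Theses.ThetaPartnerAtTwo.MazurTateCongruenceAtTwoR :=
  mazurTateCongruenceAtTwoTop_of_facts_cuspSpan hES hF hMK hSD hBz hSe h2 hG

end Crux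

end Summit.BirchSwinnertonDyer.BirchSwinnertonDyer.Theorems.MazurTateCongruenceAtTwoR

end
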